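import Summits.FinalStateConjecture.FinalStateConjecture.Theorems.SwallowTheDatumParametricKerrBurialStubBreathing
import Summits.FinalStateConjecture.FinalStateConjecture.Theorems.SwallowTheDatumParametricKerrBurialStubCollarDilationB
import Summits.FinalStateConjecture.FinalStateConjecture.Theorems.SwallowTheDatumParametricKerrBurialStubTransportPatchB

/-!
# Line certificate of `null-shell-shadow-collar` (crux `SwallowTheDatum.ParametricKerrBurial`, item
# stmt-FinalStateConjecture-10052): the crux from FOUR registered statements

With the plumbing of the line LANDED — collar dilation (`stub_collarDilationB`, p92772), transport-and-patch
(`stub_transportPatchB`, p94968), breathing (`stub_breathing`, p86339, shared with the first line), the first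
line's `junction`, and the compositions `universalCollar_of` / `ParametricKerrBurial_of_collarLine` (p84794) —
the crux `ParametricKerrBurial` follows, kernel-checked, from exactly four registered stub STATEMENTS taken as
hypotheses (arrow form, verbatim as registered on the item):

1. FAR GLUING (`stub_farGluing`, shared with line `receding-annulus-universal-collar`; Mao–Oh–Tao
   arXiv:2308.13031 Thm 1.7/1.10 + the unprinted smooth dependence on the gluing radius);
2. SHADOW COLLAR (`stub_shadowCollar`; Schwarzschild(`μ`)-seeded Klein-symmetric short pulse, Luk–Rodnianski
   arXiv:2009.08968 Thm 1.9/1.10/1.12 + Lemma 10.2 + Birkhoff; unprinted as a package);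
3. EQUIVARIANT INTERIOR SCHWARZSCHILD GLUING (`stub_interiorGluing`; Li–Mei arXiv:2005.01249 Prop 4.1 run
   under the Klein four-group);
4. SCHWARZSCHILD CYLINDER CAPPING (`stub_capping`; explicit zero-spin geometry, being formalised).

Nothing is asserted; this file is the audit trail "crux ⇐ (1, 2, 3, 4)" in one declaration.
-/

set_option linter.dupNamespace false

noncomputable section

namespace Summit.FinalStateConjecture.FinalStateConjecture.Theorems.SwallowTheDatum.ParametricKerrBurial

open scoped Manifold ContDiff Topology
open Bundle Set Filter Function Literature.Geometry.Lorentzian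

/-- **`ParametricKerrBurial` from the four open statements of the line `null-shell-shadow-collar`**: far gluing →
shadow collar → equivariant interior Schwarzschild gluing → Schwarzschild cylinder capping → the crux, by
`ParametricKerrBurial_of_collarLine` fed with `universalCollar_of` and the LANDED plumbing `stub_collarDilationB`,
`stub_transportPatchB`, `stub_breathing`. [folklore] -/
theorem ParametricKerrBurial_of_engine :
    (∀ (X : Type) [TopologicalSpace X] [ChartedSpace E3 X] [IsManifold (𝓡 3) ∞ X] [T2Space X]
      [SecondCountableTopology X] [ConnectedSpace X], ∀ d ∈ admissibleVacuumData X,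
      ∃ (η : ℝ) (e : AFEnd X) (Rstar : ℝ) (m : ℝ → ℝ) (G : ℝ → InitialDataSet (𝓡 3) X),
        0 < η ∧ e.IsSoleEnd ∧ e.R < Rstar ∧ ContDiff ℝ ∞ m ∧
        SmoothSectionsOn 𝓘(ℝ, ℝ) G {p : ℝ × X | Rstar < p.1} ∧
        ∀ R : ℝ, Rstar < R → G R ∈ admissibleVacuumData X ∧ (∀ x ∉ e.far R, AgreeAt (G R) d x) ∧
          η * R ≤ m R ∧ IsExactSchwarzschildBeyond e (G R) (m R) (32 * R)) →
    (∀ [Kerr.Facts], ∀ μ : ℝ, 0 < μ → μ ≤ 1 →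
      ∃ (M r₁ r₀ ρ₁ ρ₂ : ℝ), 0 < r₁ ∧ r₁ < r₀ ∧ r₀ < 2 * M ∧ 2 ≤ ρ₁ ∧ ρ₁ < ρ₂ ∧
        ∀ (k : ℕ) (ε : ℝ), 0 < ε →
          ∃ D : InitialDataSet (𝓡 3) E3,
            VacuumOn {y | 1 < ‖y‖ ∧ ‖y‖ < ρ₂} D ∧ IsSchwarzschildAnnulus D μ ∧
            IsKleinSymmetricOn ρ₂ D ∧ NearSchwarzschildCylinder M r₁ r₀ ρ₁ ρ₂ k ε D) →
    (∀ [Kerr.Facts], ∀ (M r₁ r₀ ρ₁ ρ₂ : ℝ), 0 < r₁ → r₁ < r₀ → r₀ < 2 * M → 2 ≤ ρ₁ → ρ₁ < ρ₂ →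
      ∃ (k : ℕ) (ε : ℝ), 0 < ε ∧
        ∀ D : InitialDataSet (𝓡 3) E3,
          VacuumOn {y | 1 < ‖y‖ ∧ ‖y‖ < ρ₂} D → IsKleinSymmetricOn ρ₂ D →
          NearSchwarzschildCylinder M r₁ r₀ ρ₁ ρ₂ k ε D →
          ∃ (D' : InitialDataSet (𝓡 3) E3) (m τ₀ ρ' : ℝ),
            (∀ y : E3, ‖y‖ < ρ₁ → D'.h.inner y = D.h.inner y ∧ D'.k y = D.k y) ∧
            VacuumOn {y | 1 < ‖y‖ ∧ ‖y‖ < ρ₂} D' ∧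
            0 < r₀ ∧ r₀ < 2 * m ∧ ρ₁ < ρ' ∧ ρ' < ρ₂ ∧
            IsSchwarzschildCylinderOn m r₀ τ₀ {y | ρ' < ‖y‖ ∧ ‖y‖ < ρ₂} D') →
    (∀ [Kerr.Facts], ∀ (D' : InitialDataSet (𝓡 3) E3) (m r₀ τ₀ ρ' ρ₂ : ℝ),
      1 ≤ ρ' → ρ' < ρ₂ → 0 < r₀ → r₀ < 2 * m →
      VacuumOn {y | 1 < ‖y‖ ∧ ‖y‖ < ρ₂} D' →
      IsSchwarzschildCylinderOn m r₀ τ₀ {y | ρ' < ‖y‖ ∧ ‖y‖ < ρ₂} D' →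
      ∃ C : InitialDataSet (𝓡 3) E3,
        (∀ y : E3, ‖y‖ ≤ ρ' → C.h.inner y = D'.h.inner y ∧ C.k y = D'.k y) ∧
        VacuumOn {y | 1 < ‖y‖} C ∧
        (∃ Mend Rend : ℝ, 0 ≤ Mend ∧ 0 < Rend ∧ IsIsotropicBeyond Mend Rend C) ∧
        IsKerrShieldedAway ρ' C) →
    Summit.FinalStateConjecture.FinalStateConjecture.Theses.SwallowTheDatum.ParametricKerrBurial :=
  fun hA hS hG hC ↦ ParametricKerrBurial_of_collarLine hA (universalCollar_of hS hG hC)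
    stub_collarDilationB stub_transportPatchB stub_breathing

end Summit.FinalStateConjecture.FinalStateConjecture.Theorems.SwallowTheDatum.ParametricKerrBurial

end
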